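import Summits.HodgeConjecture.HodgeConjecture.Theses.NikulinTwinTransport
import Summits.HodgeConjecture.HodgeConjecture.Theorems.NikulinTwinTransportHodgeSimilitudeAlgebraicTwinTransport
import Literature.AlgebraicGeometry.Surfaces.K3TwistorLines

/-!
# Crux `HodgeSimilitudeAlgebraic` (stmt-HodgeConjecture-13676, route `NikulinTwinTransport`, r5) —
# line `kummer-bkr-quaternion-carrier`, planner skeleton (lead reshape r1: Stub 2 split into 2a/2b)

Crux (the route decl, concluded BY NAME below by `HodgeSimilitudeAlgebraic_of`): for every rational
`r > 0`, every rational, type-preserving `ℂ`-linear `r`-similitude `ψ : H²(S′(ℂ);ℂ) → H²(S(ℂ);ℂ)`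
between projective K3 surfaces is `[γ]_*` for an algebraic `γ ∈ N² H⁴(S × S′)`.

## The line (idea card `Ideas/kummer-bkr-quaternion-carrier.md`, triage r1: 3 × pass)

KUMMER ANCHORS AT EVERY PRIME, ONE EXPLICIT LATTICE SIMILITUDE PER PRIME, TRANSPORT FROM THE ANCHOR.
Landed reductions of the crux (`Theorems/NikulinTwinTransportHodgeSimilitudeAlgebraic{Primes,Anchors,
TwinTransport}.lean`, prover seat 1, p70971/p71005/p71081) pin it — modulo Buskin (route item
`HodgeIsometryAlgebraic`, an ADMISSIBLE hypothesis of the composition below) and the composition of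
correspondences — to ONE statement per prime `q`: an algebraic anchor `q`-similitude for every
projective K3 surface (`AnchorAt[q]`), which follows from twin transport `TwinTransportFor[M]` for ONE
rational `q`-similitude `M` of the K3 lattice with rational inverse. This line supplies, for every
prime `q`, the KUMMER-SHAPED `M = M_q`:

* `stub_kummerCode` (card's First lemma, machine-checked p ≤ 31 by all three triagers; provable now from
  `Nat.sum_four_squares`): an integral `q`-similitude `Mc` of `ℤ¹⁶` (`Mcᵀ Mc = q·1`, four diagonal blocks
  of left multiplication by a Lipschitz quaternion of norm `q`) whose reduction mod 2 preserves the
  Reed–Muller code `RM(1,4)` (affine functions on `𝔽₂⁴` = binary digits of `Fin 16`) — i.e. an integral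
  `q`-similitude of `⟨−2⟩¹⁶` preserving the Kummer overlattice `K`.
* `stub_kummerFrame` + `stub_kummerSimilitude` (RESHAPED 2a/2b by the lead: Nikulin's Kummer lattice inside the
  tree's `Λ_{K3} = E₈(−1)² ⊕ U³` as an explicit certificate, then block linear algebra for ANY frame): a KUMMER FRAME `(u, e)` of `Λ` exists — `u` a basis of a `U(2)³`, `e` sixteen pairwise
  orthogonal `(−2)`-vectors orthogonal to `u`, the `RM(1,4)` half-sums integral, `K := sat ⟨e⟩` with glue
  exactly `RM(1,4)` (K primitive ⇒ Kummer by Nikulin's criterion) — and on it the Kummer-shaped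
  endomorphism `M` (`⊕³ diag(1, q)` on `u` = the shape of `f^*` for a degree-`q` isogeny of abelian
  surfaces in Smith bases; `Mc` on `e`) is a rational `q`-similitude of `(Λ_ℂ, k3Form)` with rational
  two-sided inverse `N` — the hypotheses `M, N, hMrat, hNrat, hMN, hNM, hMc` of `anchorAt_of_twinTransport`.
* `stub_kummerAnchor` (the ANCHOR; known mathematics, far from the tree): there is a projective period
  point `x₀` on the Kummer locus (`x₀ ⊥ e_a` for all `a`) at which the twin similitude `η⁻¹ ∘ M ∘ η′` is
  algebraic for EVERY pair of marked projective K3 surfaces with periods `(∝ M x₀, ∝ x₀)` — Kummer pair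
  `(Km A, Km A′)` of a degree-`q` isogeny `f : A → A′`: `[Z_f]_*` (Kummer correspondence of `Γ_f`) agrees
  with `η⁻¹Mη′` up to a class in `NS ⊗ NS′` (products of nodal curves `E_b × E′_a`), BSV arXiv:1510.07465
  §6.5 / Disproof.lean v3; spread to all markings at that period by strong Torelli (isomorphism graphs,
  `±Δ`, reflections in `(−2)`-curves are algebraic) and composition of correspondences.
* `stub_anchoredTransport` (THE HARDEST STUB, the research heart; informal mechanism, typed conclusion):
  algebraicity of the twin similitude at the Kummer anchor period propagates to EVERY `M`-twin pair of
  marked projective K3 surfaces, `TwinTransportFor[M]`. Mechanism of the card: the Bridgeland–King–Reid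
  image of `𝒪_{Γ_f} ⊕ 𝒪_{Γ_{−f}}` on `Km A × Km A′` (exactly hyperholomorphic at the orbifold point
  `ε = 0`: `f` is tri-holomorphic for the flat metrics `(f^*g′, g′)`), its `E ⊗ E′`-block dialled to
  `m·M_q` inside `NS ⊗ NS′`, slope-polystable for `ω_ε ⊞ ω′_ε` by perturbation in the Eguchi–Hanson
  parameter `ε`; Verbitsky hyperholomorphic transport along chains of GENERIC twin twistor lines
  (lattice half PROVED in tree: `Huybrechts_K3_periodDomain_twistorConnected_holds`); GAGA at projective
  fibres; Torelli spread at the endpoint. Informal until hyperkähler metrics / twistor families /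
  slope-polystability / Chern classes of coherent analytic sheaves exist in Literature (the route's
  standing definition requests, items 14464/14522).
* `stub_anchorFromTransport` (fact-discharge stub): twin transport for a rational `q`-similitude pair
  `(M, N)` gives `AnchorAt[q]` — PROVED in tree as `anchorAt_of_twinTransport` MODULO the three cited K3
  facts `Huybrechts_K3_periodSurjective_projective`, `Huybrechts_K3_marking_exists`,
  `Huybrechts_K3_hodgeTypes_H2` (named Literature facts are not admissible hypotheses of a skeleton
  composition; this stub lands the day they are discharged).
* `stub_compCorr`: composition of algebraic correspondences between smooth projective surfaces (Fulton
  Prop. 16.1.1; Buskin Lemma 6.3 — in tree for K3 surfaces modulo Gysin base change (hBC) and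
  `N² ∪ N² ⊆ N⁴` (hCUP): `Literature/AlgebraicGeometry/Surfaces/K3CorrespondenceComposition`), verbatim
  hypothesis (C) of `hodgeSimilitudeAlgebraic_of_prime_anchors`.

`HodgeSimilitudeAlgebraic_of (hB : HodgeIsometryAlgebraic)` composes the seven stubs (the planner's six, Stub 2 split into 2a/2b by the lead) with the landed
`hodgeSimilitudeAlgebraic_of_prime_anchors` (prime multipliers suffice: Buskin + (C) + anchors at every
prime; squares are free) — kernel-checked, no `sorry` outside `stub_*`.

## Disproof.lean used (cdisprove gen-2 v1–v4; the evidence files are not mounted on this hub, their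
## item NOTES were read, as by the three triagers)

* `crux_iff_squarefree` / `atC_sq_mul` / `isometry_imp_atC_sq` (open content = square-free multipliers,
  squares = Buskin): the line works PRIME BY PRIME and takes Buskin as the route item `hB` — honoured in
  `HodgeSimilitudeAlgebraic_of` (via `simAlgAt_div_sq`, `simAlgAt_nat_of_prime_anchors`).
* `primes_suffice : CompAlg → (∀ q prime, TwinPairAt q) → (∀ q prime, At q) → crux` — its two hidden glue
  hypotheses are EXPLICIT stubs here: `CompAlg` = `stub_compCorr`; the twin PAIR at every prime =
  `stub_kummerSimilitude` (`M` with two-sided rational inverse `N`, so both arrows exist).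
* v3 "Kummer anchors at every odd p, integral Ψ_p, algebraic graph, m = 1 (BSV §6.5)" and v4 "`At n`
  known on the Kummer-dominated locus (Ma 0905.4107)": corroborate `stub_kummerAnchor`; v3's verdict "the
  risk is the transport, once per prime" = `stub_anchoredTransport` is ranked hardest.
* hypothesis-mutation row (hrat, htype load-bearing; generator hypotheses and `0 < r` not): rationality and
  Hodge types enter through the markings (`isRationalClass_markingConj`, `isOfHodgeType_markingConj`
  inside the landed `anchorAt_of_twinTransport`), `0 < q` only to make `x ↦ M x` preserve period points.
* `no_antisimilitude`: the sign branch is not used. No `_false_without_` theorem and no landed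
  `Negative/` lemma exists for this crux (nothing to import); negatives index: 0 similitude statements.
-/

noncomputable section

set_option linter.dupNamespace false

open CategoryTheory MonoidalCategory
open scoped Manifold
open Literature.AlgebraicGeometry.Motives Literature.AlgebraicGeometry.HodgeTheory
open Literature.AlgebraicGeometry.Surfaces Literature.Geometry.Kaehler
open Literature.AlgebraicTopology.SingularHomology
open Summit.HodgeConjecture.HodgeConjecture.Theses.NikulinTwinTransport
open Summit.HodgeConjecture.HodgeConjecture.Theorems.NikulinTwinTransport

namespace Summit.HodgeConjecture.HodgeConjecture.Cruxes.HodgeSimilitudeAlgebraic.KummerBkrQuaternionCarrier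

/-! ## Local notations — verbatim those of the landed Theorems files (no new definitions) -/

/-- `MarkedK3[S, η, p, x]`: a marked K3 surface with period `x`. Local notation only, verbatim from
`NikulinTwinTransportTwinSimilitudeAlgebraicTransfer` / `…HodgeSimilitudeAlgebraicAnchors`. -/
local notation3 (prettyPrint := false) "MarkedK3[" S ", " η ", " p ", " x "]" =>
  (IsIntegralClass p ∧
    (∀ q : complexBetti S (2 * 2), IsIntegralClass q → ∃ n : ℤ, q = n • p) ∧
    (∀ c : complexBetti S (2 * 1), IsIntegralClass c ↔ ∃ v : K3Index → ℤ, η c = fun i => (v i : ℂ)) ∧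
    (∀ a b : complexBetti S (2 * 1),
        cupProduct (rfl : 2 * 1 + 2 * 1 = 2 * 2) a b = k3Form (η a) (η b) • p) ∧
    IsOfHodgeType 2 S (2 * 1) 2 0 (LinearEquiv.symm η x) ∧
    (∀ τ : complexBetti S (2 * 1), IsOfHodgeType 2 S (2 * 1) 2 0 τ → ∃ t : ℂ, τ = t • LinearEquiv.symm η x))

/-- `PeriodPt[x]`: a PROJECTIVE period point (`(x.x) = 0`, `(x̄.x) > 0`, a positive lattice vector
orthogonal to `x`). Local notation only, verbatim from the Transfer / Anchors files. -/
local notation3 (prettyPrint := false) "PeriodPt[" x "]" =>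
  (k3Form x x = 0 ∧ 0 < (k3Form (star x) x).re ∧
    ∃ u : K3Index → ℤ, k3Form (fun i => (u i : ℂ)) x = 0 ∧ 0 < ∑ i, ∑ j, u i * k3Gram i j * u j)

/-- `Corr[μ, S, S', hS, hS' ; γ, y] = [γ]_* y`. Local notation only, verbatim from the Transfer file. -/
local notation3 (prettyPrint := false) "Corr[" μ ", " S ", " S' ", " hS ", " hS' " ; " γ ", " y "]" =>
  complexGysin μ
    (IsSmoothProjective.tensor_holds (IsK3Surface.isSmoothProjective hS)
      (IsK3Surface.isSmoothProjective hS'))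
    (IsK3Surface.isSmoothProjective hS) (SemiCartesianMonoidalCategory.fst S S')
    (rfl : 2 * 1 + 2 * 2 + 2 * 2 = 2 * 1 + 2 * (2 + 2))
    (cupProduct (rfl : 2 * 1 + 2 * 2 = 2 * 1 + 2 * 2)
      (complexBetti.map (SemiCartesianMonoidalCategory.snd S S') (2 * 1) y) γ)

/-- `TwinTransportFor[M]`: THE TWIN TRANSPORT for the endomorphism `M` of `Λ_ℂ` — on every pair of marked
projective K3 surfaces whose periods correspond under `M`, the twin similitude `η⁻¹ ∘ M ∘ η'` is induced
by an algebraic class. Local notation only, verbatim from `…HodgeSimilitudeAlgebraicAnchors`. -/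
local notation3 (prettyPrint := false) "TwinTransportFor[" M "]" =>
  ∀ (μ : OrientationFamily), μ.HasPoincareDuality →
    ∀ (S S' : SchemeOver ℂ) (hS : IsK3Surface S) (hS' : IsK3Surface S')
      (η : complexBetti S (2 * 1) ≃ₗ[ℂ] (K3Index → ℂ)) (p : complexBetti S (2 * 2))
      (x : K3Index → ℂ)
      (η' : complexBetti S' (2 * 1) ≃ₗ[ℂ] (K3Index → ℂ)) (p' : complexBetti S' (2 * 2))
      (x' : K3Index → ℂ),
      MarkedK3[S, η, p, x] → PeriodPt[x] → MarkedK3[S', η', p', x'] → PeriodPt[x'] →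
      (∃ t : ℂ, M x' = t • x) →
      ∃ γ ∈ algebraicClasses (MonoidalCategoryStruct.tensorObj S S') 2,
        ∀ y : complexBetti S' (2 * 1), η.symm (M (η' y)) = Corr[μ, S, S', hS, hS' ; γ, y]

/-- `AnchorAt[c]`: an algebraic anchor `c`-similitude for every projective K3 surface. Local notation
only, verbatim from `…HodgeSimilitudeAlgebraicPrimes` (hypothesis (A) of
`hodgeSimilitudeAlgebraic_of_prime_anchors`). -/
local notation3 (prettyPrint := false) "AnchorAt[" c "]" =>
  ∀ (μ : OrientationFamily), μ.HasPoincareDuality →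
    ∀ (S : SchemeOver ℂ)
      (hS : (IsSmoothProjective 2 S ∧ Subsingleton (structureSheafCohomology S.left 1) ∧
        ∃ (A : HodgeModel 2 S) (η : MForm 𝓘(ℝ, A.model) A.carrier ℂ 2),
          IsHolomorphicInCharts η ∧ ∀ x, η x ≠ 0))
      (p : complexBetti S (2 * 2)),
      (IsIntegralClass p ∧ ∀ q : complexBetti S (2 * 2), IsIntegralClass q → ∃ n : ℤ, q = n • p) →
      ∃ (S'' : SchemeOver ℂ)
        (hS'' : (IsSmoothProjective 2 S'' ∧ Subsingleton (structureSheafCohomology S''.left 1) ∧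
          ∃ (A : HodgeModel 2 S'') (η : MForm 𝓘(ℝ, A.model) A.carrier ℂ 2),
            IsHolomorphicInCharts η ∧ ∀ x, η x ≠ 0))
        (p'' : complexBetti S'' (2 * 2)),
        (IsIntegralClass p'' ∧
          ∀ q : complexBetti S'' (2 * 2), IsIntegralClass q → ∃ n : ℤ, q = n • p'') ∧
        ∃ Ψ : complexBetti S'' (2 * 1) ≃ₗ[ℂ] complexBetti S (2 * 1),
          (∀ y, IsRationalClass y → IsRationalClass (Ψ.symm y)) ∧
          (∀ (i j : ℕ) y, IsOfHodgeType 2 S (2 * 1) i j y →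
            IsOfHodgeType 2 S'' (2 * 1) i j (Ψ.symm y)) ∧
          (∀ (u v : complexBetti S (2 * 1)) (b : ℂ),
            cupProduct (rfl : 2 * 1 + 2 * 1 = 2 * 2) u v = (c * b) • p →
              cupProduct (rfl : 2 * 1 + 2 * 1 = 2 * 2) (Ψ.symm u) (Ψ.symm v) = b • p'') ∧
          ∃ γ ∈ algebraicClasses (MonoidalCategoryStruct.tensorObj S S'') 2,
            ∀ x : complexBetti S'' (2 * 1),
              Ψ x = complexGysin μ (IsSmoothProjective.tensor_holds hS.1 hS''.1) hS.1
                (SemiCartesianMonoidalCategory.fst S S'')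
                (rfl : 2 * 1 + 2 * 2 + 2 * 2 = 2 * 1 + 2 * (2 + 2))
                (cupProduct (rfl : 2 * 1 + 2 * 2 = 2 * 1 + 2 * 2)
                  (complexBetti.map (SemiCartesianMonoidalCategory.snd S S'') (2 * 1) x) γ)

/-- `CompCorr`: composition of algebraic correspondences between smooth projective surfaces. Local
notation only, verbatim from `…HodgeSimilitudeAlgebraicPrimes` (hypothesis (C) of
`hodgeSimilitudeAlgebraic_of_prime_anchors`; Fulton Prop. 16.1.1). -/
local notation3 (prettyPrint := false) "CompCorr" =>
  ∀ (μ : OrientationFamily), μ.HasPoincareDuality →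
    ∀ (A B C : SchemeOver ℂ) (hA : IsSmoothProjective 2 A) (hB : IsSmoothProjective 2 B)
      (hC : IsSmoothProjective 2 C),
      ∀ γ ∈ algebraicClasses (MonoidalCategoryStruct.tensorObj A B) 2,
        ∀ γ₁ ∈ algebraicClasses (MonoidalCategoryStruct.tensorObj B C) 2,
          ∃ γ₂ ∈ algebraicClasses (MonoidalCategoryStruct.tensorObj A C) 2,
            ∀ x : complexBetti C (2 * 1),
              complexGysin μ (IsSmoothProjective.tensor_holds hA hC) hA
                  (SemiCartesianMonoidalCategory.fst A C)
                  (rfl : 2 * 1 + 2 * 2 + 2 * 2 = 2 * 1 + 2 * (2 + 2))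
                  (cupProduct (rfl : 2 * 1 + 2 * 2 = 2 * 1 + 2 * 2)
                    (complexBetti.map (SemiCartesianMonoidalCategory.snd A C) (2 * 1) x) γ₂) =
                complexGysin μ (IsSmoothProjective.tensor_holds hA hB) hA
                  (SemiCartesianMonoidalCategory.fst A B)
                  (rfl : 2 * 1 + 2 * 2 + 2 * 2 = 2 * 1 + 2 * (2 + 2))
                  (cupProduct (rfl : 2 * 1 + 2 * 2 = 2 * 1 + 2 * 2)
                    (complexBetti.map (SemiCartesianMonoidalCategory.snd A B) (2 * 1)
                      (complexGysin μ (IsSmoothProjective.tensor_holds hB hC) hB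
                        (SemiCartesianMonoidalCategory.fst B C)
                        (rfl : 2 * 1 + 2 * 2 + 2 * 2 = 2 * 1 + 2 * (2 + 2))
                        (cupProduct (rfl : 2 * 1 + 2 * 2 = 2 * 1 + 2 * 2)
                          (complexBetti.map (SemiCartesianMonoidalCategory.snd B C) (2 * 1) x)
                          γ₁)))
                    γ)

/-! ## Local notations of this line (pure lattice / code data over the tree's `K3Index`, `k3Gram`,
`k3Form`; no new definitions, so every stub is statable verbatim in a Theorems file) -/

/-- `SimilPair[c, M, N]`: `M` is a `ℂ`-linear `c`-similitude of `(Λ_ℂ, k3Form)` defined over `ℚ` with a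
two-sided inverse `N` defined over `ℚ` — verbatim the hypothesis bundle of `anchorAt_of_twinTransport` /
`RatTwinTransportAt[c]` and the conclusion shape of `exists_ratSimilitude_k3Lattice`. Local notation only. -/
local notation3 (prettyPrint := false) "SimilPair[" c ", " M ", " N "]" =>
  ((∀ v : K3Index → ℤ, ∃ w : K3Index → ℚ, M (fun i => (v i : ℂ)) = fun i => (w i : ℂ)) ∧
    (∀ v : K3Index → ℤ, ∃ w : K3Index → ℚ, N (fun i => (v i : ℂ)) = fun i => (w i : ℂ)) ∧
    M * N = 1 ∧ N * M = 1 ∧ (∀ a b, k3Form (M a) (M b) = c * k3Form a b))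

/-- `zC[v]`: a lattice vector `v ∈ Λ = ℤ^{22}` viewed in `Λ_ℂ`. Local notation only. -/
local notation3 (prettyPrint := false) "zC[" v "]" => (fun i : K3Index => (((v : K3Index → ℤ) i : ℤ) : ℂ))

/-- `IntForm[v, w] = vᵀ Λ w`, the integral K3 lattice form (as in `PeriodPt`). Local notation only. -/
local notation3 (prettyPrint := false) "IntForm[" v ", " w "]" =>
  (∑ i : K3Index, ∑ j : K3Index, (v : K3Index → ℤ) i * k3Gram i j * (w : K3Index → ℤ) j)

/-- `Bit[k, a] ∈ {0, 1} ⊂ ℤ`: the `k`-th binary digit of `a : Fin 16` — the identification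
`Fin 16 = 𝔽₂⁴` under which the Reed–Muller code `RM(1,4)` is the space of affine functions (Nikulin's
description of the Kummer overlattice: `A[2]` as an affine `𝔽₂⁴`). Local notation only. -/
local notation3 (prettyPrint := false) "Bit[" k ", " a "]" =>
  (((Fin.val (a : Fin 16) / 2 ^ Fin.val (k : Fin 4)) % 2 : ℕ) : ℤ)

/-- `AffineMod2[y]`: the integer vector `y : Fin 16 → ℤ` reduces mod 2 to a codeword of `RM(1,4)`,
i.e. to an affine function `a ↦ c₀ + Σ_k c_k·Bit[k,a]` on `𝔽₂⁴`. Local notation only. -/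
local notation3 (prettyPrint := false) "AffineMod2[" y "]" =>
  (∃ (c₀ : ℤ) (c : Fin 4 → ℤ), ∀ a : Fin 16,
    (2 : ℤ) ∣ (y : Fin 16 → ℤ) a - c₀ - ∑ k : Fin 4, c k * Bit[k, a])

/-- `CodeMatrix[q, Mc]`: `Mc` is an integral `q`-similitude of `ℤ¹⁶` (`Mcᵀ Mc = q·1`) whose reduction mod
2 preserves `RM(1,4)` — the card's `KummerCodeSimilitude` datum. Local notation only. -/
local notation3 (prettyPrint := false) "CodeMatrix[" q ", " Mc "]" =>
  (Matrix.transpose Mc * Mc = ((q : ℕ) : ℤ) • (1 : Matrix (Fin 16) (Fin 16) ℤ) ∧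
    ∀ y : Fin 16 → ℤ, AffineMod2[y] → AffineMod2[Matrix.mulVec Mc y])

/-- `KummerFrame[u, e]`: a KUMMER FRAME of the K3 lattice `Λ = (K3Index → ℤ, k3Gram)` — `u k s`
(`k < 3`, `s < 2`) a standard basis of a sublattice `U(2)³` (`(u k 0 . u k 1) = 2`, all other products
`0`), `e a` (`a < 16`) sixteen pairwise orthogonal `(−2)`-vectors orthogonal to `u`, the five `RM(1,4)`
half-sums `½ Σ_{Bit[k,a]=1} e_a` (`k < 4`) and `½ Σ_a e_a` integral, and the saturation of `⟨e⟩` glued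
EXACTLY by `RM(1,4)` (`2v = Σ y_a e_a ⇒ ȳ ∈ RM(1,4)`: the Kummer lattice `K` is primitive, so a K3 whose
period is orthogonal to `e` is a Kummer surface with the `e_a` its sixteen nodal classes up to sign —
Nikulin 1975). `π_* H²(A, ℤ) = U(2)³ = K^⊥`. Local notation only. -/
local notation3 (prettyPrint := false) "KummerFrame[" u ", " e "]" =>
  ((∀ (k l : Fin 3) (s t : Fin 2),
      IntForm[(u : Fin 3 → Fin 2 → K3Index → ℤ) k s, u l t] = if k = l ∧ s ≠ t then 2 else 0) ∧
    (∀ (k : Fin 3) (s : Fin 2) (a : Fin 16), IntForm[u k s, (e : Fin 16 → K3Index → ℤ) a] = 0) ∧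
    (∀ a b : Fin 16, IntForm[e a, e b] = if a = b then -2 else 0) ∧
    (∀ k : Fin 4, ∃ g : K3Index → ℤ,
      2 • g = ∑ a : Fin 16, (if (Fin.val a / 2 ^ Fin.val k) % 2 = 1 then e a else 0)) ∧
    (∃ g : K3Index → ℤ, 2 • g = ∑ a : Fin 16, e a) ∧
    (∀ (v : K3Index → ℤ) (y : Fin 16 → ℤ), 2 • v = ∑ a : Fin 16, y a • e a → AffineMod2[y]))

/-- `KummerShape[q, u, e, Mc, M]`: the endomorphism `M` of `Λ_ℂ` is KUMMER-SHAPED for the prime `q` on the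
frame `(u, e)`: `⊕³ diag(1, q)` on `u` (the Smith normal shape of `f^*` on `H²(A′,ℤ) → H²(A,ℤ) ≅ U³` for a
degree-`q` isogeny `f : A → A′`, transported to `π_*H² = U(2)³`) and the code matrix `Mc` on `e`
(`M e_a = Σ_b Mc_{ba} e_b`). Since `(u, e)` is a `ℚ`-basis of `Λ_ℚ`, this determines `M`. Local notation only. -/
local notation3 (prettyPrint := false) "KummerShape[" q ", " u ", " e ", " Mc ", " M "]" =>
  ((∀ k : Fin 3, M zC[(u : Fin 3 → Fin 2 → K3Index → ℤ) k 0] = zC[u k 0] ∧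
      M zC[u k 1] = ((q : ℕ) : ℂ) • zC[u k 1]) ∧
    (∀ a : Fin 16, M zC[(e : Fin 16 → K3Index → ℤ) a] =
      ∑ b : Fin 16, (((Mc : Matrix (Fin 16) (Fin 16) ℤ) b a : ℤ) : ℂ) • zC[e b]))

/-- `AlgebraicAtPeriod[M, x₀]`: the twin transport `TwinTransportFor[M]` RESTRICTED to `M`-twin pairs
whose second period is (a multiple of) `x₀` — "the twin similitude `η⁻¹ ∘ M ∘ η'` is algebraic for every
pair of marked projective K3 surfaces with periods `(∝ M x₀, ∝ x₀)`". `TwinTransportFor[M]` is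
`∀ x₀, AlgebraicAtPeriod[M, x₀]` (`twinTransportFor_iff_forall_algebraicAtPeriod` below). Local notation only. -/
local notation3 (prettyPrint := false) "AlgebraicAtPeriod[" M ", " x₀ "]" =>
  ∀ (μ : OrientationFamily), μ.HasPoincareDuality →
    ∀ (S S' : SchemeOver ℂ) (hS : IsK3Surface S) (hS' : IsK3Surface S')
      (η : complexBetti S (2 * 1) ≃ₗ[ℂ] (K3Index → ℂ)) (p : complexBetti S (2 * 2))
      (x : K3Index → ℂ)
      (η' : complexBetti S' (2 * 1) ≃ₗ[ℂ] (K3Index → ℂ)) (p' : complexBetti S' (2 * 2))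
      (x' : K3Index → ℂ),
      MarkedK3[S, η, p, x] → PeriodPt[x] → MarkedK3[S', η', p', x'] → PeriodPt[x'] →
      (∃ t : ℂ, M x' = t • x) → (∃ s : ℂ, x' = s • (x₀ : K3Index → ℂ)) →
      ∃ γ ∈ algebraicClasses (MonoidalCategoryStruct.tensorObj S S') 2,
        ∀ y : complexBetti S' (2 * 1), η.symm (M (η' y)) = Corr[μ, S, S', hS, hS' ; γ, y]

/-! ## Sanity (proved): the anchor predicate is the pointwise restriction of twin transport -/

/-- `TwinTransportFor[M]` is exactly `AlgebraicAtPeriod[M, x₀]` for every `x₀` (restrict; conversely take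
`x₀ := x'`, `s = 1`). [folklore] -/
theorem twinTransportFor_iff_forall_algebraicAtPeriod (M : Module.End ℂ (K3Index → ℂ)) :
    TwinTransportFor[M] ↔ ∀ x₀ : K3Index → ℂ, AlgebraicAtPeriod[M, x₀] := by
  constructor
  · intro h x₀ μ hμ S S' hS hS' η p x η' p' x' hm hx hm' hx' hper _
    exact h μ hμ S S' hS hS' η p x η' p' x' hm hx hm' hx' hper
  · intro h μ hμ S S' hS hS' η p x η' p' x' hm hx hm' hx' hper
    exact h x' μ hμ S S' hS hS' η p x η' p' x' hm hx hm' hx' hper ⟨1, (one_smul ℂ x').symm⟩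

/-! ## The registered stubs -/

/-- **Stub 1 — `stub_kummerCode` (the card's First lemma `KummerCodeSimilitude`; size M, provable now).**
For every prime `q` there is `Mc ∈ M₁₆(ℤ)` with `Mcᵀ Mc = q·1` whose reduction mod 2 maps affine functions
on `𝔽₂⁴` (= `Fin 16` read in binary, `Bit`) to affine functions, i.e. preserves `RM(1,4)`. Proof sketch:
`q = a²+b²+c²+d²` (`Nat.sum_four_squares`); `Mc = diag(L_x, L_x, L_x, L_x)`, `L_x` = left multiplication
by the Lipschitz quaternion `x = a+bi+cj+dk` on a block `{4m, …, 4m+3}` with `(Bit 0, Bit 1) ↔ (1, i, j, k)`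
via `00 ↦ 1, 10 ↦ i, 01 ↦ j, 11 ↦ k`; `L_xᵀ L_x = N(x)·1` (Euler); mod 2, `L_i, L_j, L_k` are the three
non-trivial translations of the plane `𝔽₂²` (signs die), so `L̄_x = a + b T₁₀ + c T₀₁ + d T₁₁` in
`𝔽₂[𝔽₂²]` and an affine `y` goes to `(a+b+c+d)·y + const`; `q` odd ⇒ `a+b+c+d` odd; `q = 2`, `x = 1+i`:
`y ↦ y + y∘T₁₀ = const`. Machine-checked for every Lipschitz quaternion of norm `q ≤ 31` (triage jobs
j007434 / j007489, and this planner's `scratch/code_check.py` in the exact `Bit` indexing, q ≤ 23).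
Why it might need reshaping: only the indexing convention (`Bit`), not the mathematics. [folklore] -/
theorem stub_kummerCode :
    ∀ q : ℕ, q.Prime → ∃ Mc : Matrix (Fin 16) (Fin 16) ℤ, CodeMatrix[q, Mc] := by
  sorry

/-- **Stub 2a — `stub_kummerFrame` (RESHAPED by the lead, 2026-08-16: the planner's Stub 2 part (i),
split off as the free seventh slot foresaw; size M, a finite certificate).** The tree's K3 lattice
`Λ = (K3Index → ℤ, k3Gram) = E₈(−1)² ⊕ U³` contains a KUMMER FRAME `(u, e)`: `u k s` a standard
basis of a `U(2)³`, `e a` sixteen pairwise orthogonal `(−2)`-vectors orthogonal to `u`, the five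
`RM(1,4)` half-sums integral, and the saturation of `⟨e⟩` glued EXACTLY by `RM(1,4)` (Nikulin 1975 /
Morrison 1984 §3: `H²(Km A, ℤ) ⊇ U(2)³ ⊕ K`, `K` primitive). An explicit frame with entries in
`[−8, 8]` was computed by the lead (work/frame/kummer_frame.py: glue the abstract Kummer lattice,
split off `U³`, identify the complement as `E₈(−1)²` by its root system, read coordinates; all
clauses re-verified in exact arithmetic, saturation via eleven parity witnesses for a basis of
`RM(2,4) = RM(1,4)^⊥`). Proof in Lean: the frame as five literal block matrices, `Fᵀ·k3Gram·F =
diag(U(2)³, −2·1₁₆)` and the glue identities by `decide`, the saturation clause by pairing with the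
eleven witnesses and a 16-case parity check. [cite: Morrison1984, §3 (Kummer lattice)] -/
theorem stub_kummerFrame :
    ∃ (u : Fin 3 → Fin 2 → K3Index → ℤ) (e : Fin 16 → K3Index → ℤ), KummerFrame[u, e] := by
  sorry

/-- **Stub 2b — `stub_kummerSimilitude` (RESHAPED by the lead, 2026-08-16: the planner's Stub 2 part
(ii), now for an ARBITRARY Kummer frame; size M, abstract matrix algebra).** Given a prime `q`, a code
matrix `Mc` (`Mcᵀ Mc = q·1`) and ANY Kummer frame `(u, e)` of `Λ`, there are `ℂ`-linear endomorphisms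
`M, N` of `Λ_ℂ` with `M` Kummer-shaped on the frame (`⊕³ diag(1, q)` on `u`, `Mc` on `e`) and `(M, N)`
a rational `q`-similitude pair (`M, N` defined over `ℚ`, `MN = NM = 1`, `(Ma.Mb) = q (a.b)`). Proof
sketch: let `F : Matrix K3Index J ℤ` (`J = 22` frame indices) have the frame vectors as columns; the
first three clauses of `KummerFrame` say `Fᵀ G F = G_fr := diag(U(2)³, −2·1₁₆)` (`G = k3Gram`), so
`F' := G_fr⁻¹ Fᵀ G` (entries in `½ℤ`) is a two-sided inverse of `F` over `ℚ` (`F'F = 1`, squareness by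
`card J = 22`); put `D := diag(1, q)³ ⊕ Mc`, `M := F D F'`, `N := F D⁻¹ F'` with `D⁻¹ = diag(1, q⁻¹)³ ⊕
q⁻¹ Mcᵀ`; then `M F = F D` (Kummer shape), `MN = NM = 1`, and `Mᵀ G M = F'ᵀ (Dᵀ G_fr D) F' =
q F'ᵀ G_fr F' = q G` because `Dᵀ G_fr D = q G_fr` blockwise (`diag(1,q) U(2) diag(1,q) = q U(2)`,
`Mcᵀ (−2) Mc = −2q`) and `F'ᵀ G_fr F' = G F G_fr⁻¹ Fᵀ G = G` (from `F F' = 1`). Pattern in tree: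
`exists_ratSimilitude_k3Lattice` (`Matrix.toLin'`, `k3Form_eq_dotProduct`, `ratCast_map_mulVec`).
[folklore] -/
theorem stub_kummerSimilitude :
    ∀ q : ℕ, q.Prime → ∀ Mc : Matrix (Fin 16) (Fin 16) ℤ, CodeMatrix[q, Mc] →
      ∀ (u : Fin 3 → Fin 2 → K3Index → ℤ) (e : Fin 16 → K3Index → ℤ), KummerFrame[u, e] →
      ∃ (M N : Module.End ℂ (K3Index → ℂ)),
        KummerShape[q, u, e, Mc, M] ∧ SimilPair[((q : ℕ) : ℂ), M, N] := by
  sorry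

/-- **Stub 3 — `stub_kummerAnchor` (THE KUMMER ANCHOR at every prime; known mathematics, size L–XL in
the tree).** For every prime `q`, Kummer frame `(u, e)`, code matrix `Mc` and Kummer-shaped rational
`q`-similitude `M`, there is a PROJECTIVE period point `x₀` on the Kummer locus (`x₀ ⊥ e_a` for all `a`,
so `NS ⊇ K` and every marked K3 at that period is a Kummer surface `Km A′`, Nikulin) such that the twin
similitude `η⁻¹ ∘ M ∘ η′` is algebraic for EVERY pair of marked projective K3 surfaces with periods
`(∝ M x₀, ∝ x₀)`. Proof sketch: realise `x₀ ∈ ℂu` as the period of `Km A′` for an abelian surface `A′`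
marked by `u` (Smith basis), and `M x₀ = (⊕ diag(1,q)) x₀` as the period of `Km A` for the degree-`q`
isogeny `f : A → A′` with `f^* = ⊕³ diag(1, q)` (`A := ` the cover defined by the index-`q` sublattice);
the Kummer correspondence `Z_f ⊂ Km A × Km A′` (closure of the graph of the rational map induced by
`f`) acts as `π_* f^* π′^*`-shape on `π′_*H²(A′)` and as the PERMUTATION `E′_{a′} ↦ E_{f⁻¹a′}` on the
nodal classes (for `q = 2`: `E′_{a′} ↦` the sum over its 2-torsion preimages, two or none), so `η⁻¹Mη′ − [Z_f]_*` is supported in the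
block `K′ → K`, a `ℚ`-combination of the algebraic classes `E_b × E′_a` ⇒ `η⁻¹ M η′` algebraic at ONE
marked pair (BSV arXiv:1510.07465 §6.5, §2.4; Disproof.lean v3; alternatively HC for the abelian fourfold
`A × A′`, Ramón-Marí 2008 Prop. 2.18 / Markman 2025, descended along the Kummer quotients); then STRONG
TORELLI spreads it to all marked pairs at the same periods (`η₁⁻¹η₀` between two marked K3s with the same
period is `± w ∘ g^*` for an isomorphism `g` and a product `w` of reflections in `(−2)`-curves — graphs,
`Δ`, `Δ + C × C` are algebraic) + composition of correspondences (`stub_compCorr`). Non-vacuous given the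
period facts (`Huybrechts_K3_periodSurjective_projective` realises `x₀`). Why it might fail AS TYPED: only
through a convention slip (sign of `p`, direction of `M`), not mathematically. [cite: Morrison1984, §3 (Kummer lattice) and §5–6 (Shioda–Inose, even sets)] -/
theorem stub_kummerAnchor :
    ∀ q : ℕ, q.Prime →
      ∀ (u : Fin 3 → Fin 2 → K3Index → ℤ) (e : Fin 16 → K3Index → ℤ)
        (Mc : Matrix (Fin 16) (Fin 16) ℤ) (M : Module.End ℂ (K3Index → ℂ)),
        KummerFrame[u, e] → CodeMatrix[q, Mc] → KummerShape[q, u, e, Mc, M] →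
        (∀ a b, k3Form (M a) (M b) = ((q : ℕ) : ℂ) * k3Form a b) →
        ∃ x₀ : K3Index → ℂ,
          PeriodPt[x₀] ∧ (∀ a : Fin 16, k3Form zC[e a] x₀ = 0) ∧ AlgebraicAtPeriod[M, x₀] := by
  sorry

/-- **Stub 4 — `stub_anchoredTransport` (THE HARDEST STUB: transport from the Kummer anchor to every
twin pair; OPEN — the research heart of the line, informal mechanism with a typed conclusion).** For a
prime `q`, a Kummer frame `(u, e)`, a code matrix `Mc`, the Kummer-shaped rational `q`-similitude `M`, and
a projective period `x₀` on the Kummer locus at which the twin similitude is algebraic for all marked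
pairs, the twin similitude is algebraic at EVERY period `x₁`, i.e. on every `M`-twin pair of marked
projective K3 surfaces (`∀ x₁, AlgebraicAtPeriod[M, x₁]` = `TwinTransportFor[M]` by
`twinTransportFor_iff_forall_algebraicAtPeriod`; non-projective / non-period `x₁` are vacuous). Mechanism (card + triage sharpenings): (a) CARRIER at the anchor — the
Bridgeland–King–Reid image `F₀ = BKR(𝒪_{Γ_f} ⊕ 𝒪_{Γ_{−f}}, χ)` on `Km A × Km A′`, `ch₂^{H²⊗H²}(F₀) =
graph(f^*)` + twisted-sector terms in `⟨E_a ⊗ E′_b⟩`, dialled by characters / 2-torsion translates / cones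
along the quadrics `E_a × E′_b` to `m·graph(M)` (`M = f^* ⊕ Mc`, integral on `U(2)³ ⊕ K` by
`stub_kummerCode`), every other `ch_i` cleaned into the generically-Hodge span
`⟨1, h⊗1, 1⊗h′, graph(M), h⊗h′, pt⊗1, 1⊗pt′, h⊗pt′, pt⊗h′, pt⊗pt′⟩`; `F₀` is EXACTLY hyperholomorphic
at the orbifold point `ε = 0` (`f` is a local isometry for the flat metrics `(f^*g′, g′)`, hence
tri-holomorphic; `(ℤ/2)²` acts by tri-holomorphic isometries), and slope-polystability for the
Eguchi–Hanson Kähler classes `ω_ε ⊞ ω′_ε` (`ω′_ε` `M⁻¹`-matched) is a perturbation problem at `ε = 0`;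
(b) TRANSPORT — `graph(M)` is `SU(2)`-invariant for `M`-matched product hyperkähler structures (`M` is
conformal on positive 3-planes), Verbitsky's theorem carries the polystable sheaf along the product
twistor line over a GENERIC twin twistor line, and any two period points are joined by chains of generic
twistor lines (lattice half PROVED: `Huybrechts_K3_periodDomain_twistorConnected_holds`; Buskin's
stability bookkeeping at Picard-rank-0 junctions); (c) ENDPOINT — at projective fibres GAGA makes the
transported sheaf algebraic, so its `c₂` and hence `m·(η⁻¹Mη′) + (NS⊗NS′, vertical, horizontal terms)`
is algebraic; divide by `m`, subtract the algebraic corrections (Lefschetz (1,1) on both factors), and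
spread over all markings at that period by strong Torelli as in Stub 3. Informal until the route's
definition requests land (hyperkähler metric / twistor family of K3 × K3, slope-polystability w.r.t. a
Kähler class, Chern classes of coherent analytic sheaves in `complexBetti`). Barriers: Voisin2002 /
Zucker1977 bite only the non-projective ROAD (sheaves, not cycles, are transported; algebraicity is read at
projective endpoints only); honest residual = route kill criterion (ii) (a Voisin-type vanishing of the
graph component of `c₂` of every sheaf on a very general twin pair). Why it might fail: polystability of the
dialled BKR object may fail for every `M`-matched Kähler pair near `ε = 0` (then fall back to the route's
Serre/elementary-modification carriers or to the semiregular / reduced-DT4 engines of the sibling lines,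
which consume the SAME anchor `x₀`). [cite: Verbitsky1996Hyperholomorphic, Thm. 2.5] [cite: Buskin2019, §4–§6] [cite: Huybrechts2016K3, Ch. 7 §3 Prop. 3.2, Prop. 3.7] -/
theorem stub_anchoredTransport :
    ∀ q : ℕ, q.Prime →
      ∀ (u : Fin 3 → Fin 2 → K3Index → ℤ) (e : Fin 16 → K3Index → ℤ)
        (Mc : Matrix (Fin 16) (Fin 16) ℤ) (M : Module.End ℂ (K3Index → ℂ)) (x₀ : K3Index → ℂ),
        KummerFrame[u, e] → CodeMatrix[q, Mc] → KummerShape[q, u, e, Mc, M] →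
        (∀ a b, k3Form (M a) (M b) = ((q : ℕ) : ℂ) * k3Form a b) →
        PeriodPt[x₀] → (∀ a : Fin 16, k3Form zC[e a] x₀ = 0) → AlgebraicAtPeriod[M, x₀] →
        ∀ x₁ : K3Index → ℂ, AlgebraicAtPeriod[M, x₁] := by
  sorry

/-- **Stub 5 — `stub_anchorFromTransport` (fact-discharge stub; PROVED in tree modulo the three cited K3
facts, size L because the facts are deep).** Twin transport for ONE rational `q`-similitude pair `(M, N)`
of the K3 lattice gives an algebraic anchor `q`-similitude for EVERY projective K3 surface: mark `S`, push
its period through `N`, realise the twin period by a marked projective `S″` (surjectivity of the period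
map), and read `Ψ = η⁻¹ M η″` (algebraic by the transport) and `Ψ⁻¹ = η″⁻¹ N η` (rational, type-preserving,
divides the form by `q`). This is LITERALLY `anchorAt_of_twinTransport (q : ℚ) _ hP hMk hHT M N …` of
`Theorems/NikulinTwinTransportHodgeSimilitudeAlgebraicAnchors.lean` followed by `Rat.cast_natCast` (cf.
`anchorAt_nat_of_twinTransport`), with `hP : Huybrechts_K3_periodSurjective_projective`,
`hMk : Huybrechts_K3_marking_exists`, `hHT : Huybrechts_K3_hodgeTypes_H2` — named Literature facts
(Huybrechts, *Lectures on K3 Surfaces*, Ch. 6 Thm 3.1 / Ch. 7 Thm 4.1; Ch. 1 Prop. 3.5; Ch. 3) that a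
skeleton composition may not take as hypotheses; the stub lands the day they are discharged (or the lead
re-registers it with the facts as hypotheses if the gate starts admitting `[cite]`d facts). Why it might
fail: it cannot, short of a mis-rendering of the facts. [cite: Huybrechts2016K3, Ch. 1 Prop. 3.5, Ch. 6 Prop. 1.2, Rem. 3.3, Ch. 7 Thm. 4.1] [cite: Buskin2019, §6.2] -/
theorem stub_anchorFromTransport :
    ∀ q : ℕ, q.Prime → ∀ (M N : Module.End ℂ (K3Index → ℂ)),
      SimilPair[((q : ℕ) : ℂ), M, N] → TwinTransportFor[M] → AnchorAt[((q : ℕ) : ℂ)] := by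
  sorry

/-- **Stub 6 — `stub_compCorr` (composition of algebraic correspondences between smooth projective
surfaces; size L, formal debt of the tree).** For algebraic `γ ∈ N² H⁴(A × B)`, `γ₁ ∈ N² H⁴(B × C)` there is
an algebraic `γ₂ ∈ N² H⁴(A × C)` with `[γ₂]_* = [γ]_* ∘ [γ₁]_*` on `H²(C(ℂ);ℂ)` — Fulton Prop. 16.1.1 /
Buskin Lemma 6.3: `γ₂ = p₁₃_*(p₁₂^*γ ∪ p₂₃^*γ₁)`; in tree for K3 surfaces as `corrComp_of_baseChange`
(`Literature/AlgebraicGeometry/Surfaces/K3CorrespondenceComposition`) MODULO Gysin base change for the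
product square (hBC) and `N² ∪ N² ⊆ N⁴` on the sixfold (hCUP, Chow's moving lemma); verbatim hypothesis
(C) of `hodgeSimilitudeAlgebraic_of_prime_anchors` / `similitudeAlgebraic_of_anchor` and Disproof.lean's
`CompAlg`. Only K3 instances are consumed. Why it might fail: not mathematically; (hBC) needs the Künneth
cross product for the tree's singular cohomology. [cite: Fulton1998, §16.1 Prop. 16.1.1] [cite: Buskin2019, Lemma 6.3] -/
theorem stub_compCorr : CompCorr := by
  sorry

/-! ## The kernel-checked composition: the seven stubs (+ Buskin, route item `HodgeIsometryAlgebraic`)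
imply the crux BY NAME -/

/-- **The line closes the crux.** Prime multipliers suffice (landed
`hodgeSimilitudeAlgebraic_of_prime_anchors`: Buskin `hB` + composition `stub_compCorr` + an anchor at
every prime; squares of rationals are free), and at the prime `q`: the code similitude (Stub 1) extends to
the Kummer-shaped rational `q`-similitude `M` of `Λ_{K3}` on an explicit Kummer frame (Stubs 2a, 2b), the twin similitude for `M` is
algebraic at the Kummer anchor period (Stub 3), transports to every period (Stub 4, turned into
`TwinTransportFor[M]` by the proved `twinTransportFor_iff_forall_algebraicAtPeriod`), and twin transport
gives the anchor `q`-similitude for every projective K3 surface (Stub 5). The only hypothesis is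
the route item `HodgeIsometryAlgebraic` (Buskin's theorem as rendered, item stmt-HodgeConjecture-13675,
rank 2), by name. [folklore] -/
theorem HodgeSimilitudeAlgebraic_of (hB : HodgeIsometryAlgebraic) : HodgeSimilitudeAlgebraic := by
  refine hodgeSimilitudeAlgebraic_of_prime_anchors hB stub_compCorr fun q hq => ?_
  obtain ⟨Mc, hMc⟩ := stub_kummerCode q hq
  obtain ⟨u, e, hF⟩ := stub_kummerFrame
  obtain ⟨M, N, hSh, hMN⟩ := stub_kummerSimilitude q hq Mc hMc u e hF
  obtain ⟨x₀, hx₀, hK, hA⟩ := stub_kummerAnchor q hq u e Mc M hF hMc hSh hMN.2.2.2.2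
  exact stub_anchorFromTransport q hq M N hMN
    ((twinTransportFor_iff_forall_algebraicAtPeriod M).2
      (stub_anchoredTransport q hq u e Mc M x₀ hF hMc hSh hMN.2.2.2.2 hx₀ hK hA))

end Summit.HodgeConjecture.HodgeConjecture.Cruxes.HodgeSimilitudeAlgebraic.KummerBkrQuaternionCarrier

end
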